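/-
Copyright (c) 2026 the pub-hodgecm-mathlib formalisation cell (harness21).  Prover seat hodgecm-mathlib-K2E3-p20 (g5), Track B «K2-LIT» ∕ h413
(`stmt-HodgeConjecture-24833`), line `K2_E3_EllipticInputs`, unit U12 §L, kernel road «RICHARDSON» for (L-B_GL) at `N = 3` (road owner K2E3-p11 (g4)),
brick (R2-Borel), Lie side ∕ (B3) part 1: THE REGULAR NILPOTENT ORBIT'S MEASURE `Λ_J` ON `𝔤𝔩₃(F)` — dictionary, `Ad`-invariance, Radon.  2026-09-04.
-/
import Summits.HodgeConjecture.HodgeConjecture.Theorems.K2E3GL3BorelUnipotentMeasureConjInvariant   -- ★ p857420 (this seat): group side `GL3.map_conj_borelUnipotentMeasure_eq`, finiteness on compacta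
import Summits.HodgeConjecture.HodgeConjecture.Theorems.K2E3GL3NilpotentOrbits                        -- ★ R1a p857297 (K2E3-p11 g4): `isNilpotent_conj`, `pow_three_eq_zero_of_isNilpotent`
import HarnessLib

/-!
# K2_E3 road (h413), §L — kernel road «RICHARDSON» for (L-B_GL) at `N = 3`, brick (R2-Borel), Lie side, part 1: the regular nilpotent orbit's Richardson measure
# `Λ_J = (Ad(k)(u − 1))_*(κ ⊗ μ_{N₃})` on `𝔤𝔩₃(F)` is an `Ad`-invariant Radon measure

Cell `pub/hodgecm-mathlib` (D-0151), Track B, seat K2E3-p20 (g5); road owner K2E3-p11 (g4), §L lead K2E3-p12 (g4), dealer K2E3-plan (g3).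
`--supports stmt-HodgeConjecture-24833 --as helper`; THEOREMS ONLY (no definition ∕ instance ∕ notation ∕ named fact ∕ `sorry`); never imports `Cruxes/…/Lines`.
COUNT-NEUTRAL ((L-B_GL) ∕ (LBGL-ge3) `sig_K2E3GLnNilpotentFourierRegularGeThree` stay OPEN: the REGULARITY half (b) of `μ̂_E`, `μ̂_J` is not here).

THE MATHEMATICS.  `G = GL₃(F)` (`F` non-archimedean local), `K = GL₃(𝒪)`, `N₃` upper unitriangular, Haar `κ`, `μ_N`; `Λ := (k u k⁻¹)_*(κ ⊗ μ_N)` on `G` is conjugation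
invariant and finite on compacta (★ p857420).  On the Lie algebra `𝔤 = 𝔤𝔩₃(F)` put **`Λ_J := (Ad(k)(u − 1))_*(κ ⊗ μ_N) = (g ↦ g − 1)_* Λ`** (since `k u k⁻¹ − 1 = k(u − 1)k⁻¹`):
* §2 `map_borelRichardson_eq_map_map` (the dictionary), **`GL3.map_Ad_borelRichardsonMeasure_eq`** (`Ad(g)_* Λ_J = Λ_J`: `Ad(g) ∘ (· − 1) = (· − 1) ∘ Int(g)` and p857420);
* §2 **`isFiniteMeasureOnCompacts_borelRichardsonMeasure`** (`Λ_J(C) ≤ Λ(D)` with `D = {h | h − 1 ∈ C, (h − 1)³ = 0}` compact in `G`: on `D`, `h⁻¹ = 1 − (h−1) + (h−1)²`);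
* §1 `measure_eq_zero_of_pairwise_disjoint_translates` — a measurable set with infinitely many pairwise disjoint left translates by elements of a compact set is null for a
  left-invariant measure finite on compacta (used by the sequel for `{u ∈ N₃ | u_{ij} = 0}`).
The sequel `K2E3GL3NilpotentStructure` proves `Λ_J((Ad·J)ᶜ) = 0`, `Λ_J ≠ 0` and closes **`J(𝒩)(𝔤𝔩₃(F)) = ℂδ₀ ⊕ ℂΛ_E ⊕ ℂΛ_J` with both Richardson measures explicit**
over ★ p857400 (K2E3-p21 (g4)) and ★ (R1d) p857363.
[HarishChandra1999AdmissibleDistributions, §3 pp. 8–10, Thm. 3.9, Cor. 3.10 (Deligne–Rao: nilpotent orbital integrals are invariant Radon measures)]; [Howe1974, Prop. 2];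
[Rogawski1990, §4.13 Lemma 4.13.1 (a)]; [BernsteinZelevinsky1976, §1.18].

HONEST LABEL: HC_CM is proved only modulo the 7 printed citations (2 remaining named inputs: hLiu418 = stmt-HodgeConjecture-24832, h413 = stmt-HodgeConjecture-24833)
until rung 0 closes; count-neutral helper.
-/

set_option autoImplicit false
set_option linter.dupNamespace false   -- `Summit.HodgeConjecture.HodgeConjecture.…` (D-0017 nested layout; lakefile exemption for Summits)

noncomputable section

open MeasureTheory MeasureTheory.Measure Filter Topology Set TopologicalSpace ValuativeRel
open scoped MatrixGroups NNReal ENNReal Pointwise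
open Literature.NumberTheory.Automorphic Literature.NumberTheory.Rogawski1990 Literature.MeasureTheory.Group
open Literature.NumberTheory.GaloisRepresentations Literature.NumberTheory.GaloisRepresentations.IsNonarchimedeanLocalField
open Summit.HodgeConjecture.HodgeConjecture.Cruxes.H413.K2E3GL3NilpotentOrbits
open Summit.HodgeConjecture.HodgeConjecture.Cruxes.H413.K2E3GL3BorelUnipotentMeasureConjInvariant

namespace Summit.HodgeConjecture.HodgeConjecture.Cruxes.H413.K2E3GL3BorelRichardsonMeasure

/-! ## §1  Generic: a set with infinitely many pairwise disjoint translates inside a compact is null for a left Haar measure -/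

section Null

variable {N : Type*} [Group N] [TopologicalSpace N] [IsTopologicalGroup N] [MeasurableSpace N] [BorelSpace N] [T2Space N] [SigmaCompactSpace N]

/-- **Null by disjoint translates.**  `μ` left-invariant and finite on compacta on a σ-compact Hausdorff group `N`; `H ⊆ N` measurable; `u : ℕ → N` inside a compact
`K₀` with the left translates `u_m H` pairwise disjoint.  Then `μ H = 0`: for every compact `C` the `n` sets `u_m (H ∩ C)`, `m < n`, are disjoint, of measure
`μ(H ∩ C)`, inside the compact `K₀ C`, so `n · μ(H ∩ C) ≤ μ(K₀ C) < ∞` for all `n`. [folklore] -/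
theorem measure_eq_zero_of_pairwise_disjoint_translates (μ : Measure N) [μ.IsMulLeftInvariant] [IsFiniteMeasureOnCompacts μ]
    {H : Set N} (hH : MeasurableSet H) (u : ℕ → N) (hdisj : Pairwise fun i j => Disjoint ((fun h => (u i)⁻¹ * h) ⁻¹' H) ((fun h => (u j)⁻¹ * h) ⁻¹' H))
    {K₀ : Set N} (hK₀ : IsCompact K₀) (huK : ∀ i, u i ∈ K₀) : μ H = 0 := by
  -- reduce to compact pieces
  suffices hC : ∀ C : Set N, IsCompact C → μ (H ∩ C) = 0 by
    have hcov : H = ⋃ n, H ∩ compactCovering N n := by rw [← Set.inter_iUnion, iUnion_compactCovering, Set.inter_univ]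
    rw [hcov]
    exact measure_iUnion_null fun n => hC _ (isCompact_compactCovering N n)
  intro C hC
  set S : Set N := H ∩ C with hS
  have hSm : MeasurableSet S := hH.inter hC.isClosed.measurableSet
  -- the translates `Q i = u_i S`
  set Q : ℕ → Set N := fun i => (fun h => (u i)⁻¹ * h) ⁻¹' S with hQ
  have hQm : ∀ i, MeasurableSet (Q i) := fun i => hSm.preimage (measurable_const_mul _)
  have hQμ : ∀ i, μ (Q i) = μ S := fun i => measure_preimage_mul μ _ _
  have hQdisj : Pairwise fun i j => Disjoint (Q i) (Q j) := fun i j hij =>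
    (hdisj hij).mono (Set.preimage_mono Set.inter_subset_left) (Set.preimage_mono Set.inter_subset_left)
  have hQsub : ∀ i, Q i ⊆ K₀ * C := fun i h hh => by
    have h1 : (u i)⁻¹ * h ∈ C := hh.2
    exact ⟨u i, huK i, (u i)⁻¹ * h, h1, by group⟩
  have hbig : IsCompact (K₀ * C) := hK₀.mul hC
  -- `n · μ S ≤ μ (K₀ C)` for all `n`
  have hle : ∀ n : ℕ, (n : ℝ≥0∞) * μ S ≤ μ (K₀ * C) := fun n => by
    have hsum : μ (⋃ i ∈ Finset.range n, Q i) = ∑ i ∈ Finset.range n, μ (Q i) :=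
      measure_biUnion_finset (fun i _ j _ hij => hQdisj hij) fun i _ => hQm i
    simp only [hQμ, Finset.sum_const, Finset.card_range, nsmul_eq_mul] at hsum
    rw [← hsum]
    exact measure_mono (Set.iUnion₂_subset fun i _ => hQsub i)
  by_contra h0
  obtain ⟨n, hn⟩ := ENNReal.exists_nat_mul_gt h0 (hbig.measure_lt_top (μ := μ)).ne
  exact absurd (hle n) (not_le.2 hn)

end Null

/-! ## §2  `Λ_J` on `𝔤𝔩₃(F)`: the dictionary with the group measure, `Ad`-invariance, finiteness on compacta -/

section GL3

variable (F : Type*) [Field F] [ValuativeRel F] [TopologicalSpace F] [IsNonarchimedeanLocalField F]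
  [MeasurableSpace (GL (Fin 3) F)] [BorelSpace (GL (Fin 3) F)] [MeasurableSpace (Matrix (Fin 3) (Fin 3) F)] [BorelSpace (Matrix (Fin 3) (Fin 3) F)]
  (κ : Measure ↥(glInt 3 F)) (μN : Measure ↥(unipotentRadicalGL F (id : Fin 3 → Fin 3)))

omit [ValuativeRel F] [TopologicalSpace F] [IsNonarchimedeanLocalField F] [MeasurableSpace (GL (Fin 3) F)] [BorelSpace (GL (Fin 3) F)]
  [MeasurableSpace (Matrix (Fin 3) (Fin 3) F)] [BorelSpace (Matrix (Fin 3) (Fin 3) F)] in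
/-- The dictionary `g h g⁻¹ − 1 = g (h − 1) g⁻¹` between `Int(g)` on `GL₃` and `Ad(g)` on `𝔤𝔩₃`. [folklore] -/
theorem coe_conj_sub_one (g h : GL (Fin 3) F) :
    (((g * h * g⁻¹ : GL (Fin 3) F)) : Matrix (Fin 3) (Fin 3) F) - 1 =
      (g : Matrix (Fin 3) (Fin 3) F) * ((h : Matrix (Fin 3) (Fin 3) F) - 1) * ((g⁻¹ : GL (Fin 3) F) : Matrix (Fin 3) (Fin 3) F) := by
  rw [Matrix.mul_sub, Matrix.sub_mul, Matrix.mul_one, Units.mul_inv, Units.val_mul, Units.val_mul]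

/-- `(k, u) ↦ Ad(k)(u − 1)` is measurable. [folklore] -/
theorem measurable_borelRichardsonMap :
    Measurable fun q : ↥(glInt 3 F) × ↥(unipotentRadicalGL F (id : Fin 3 → Fin 3)) =>
      ((q.1 : GL (Fin 3) F) : Matrix (Fin 3) (Fin 3) F) * (((q.2 : GL (Fin 3) F) : Matrix (Fin 3) (Fin 3) F) - 1) *
        (((q.1 : GL (Fin 3) F)⁻¹ : GL (Fin 3) F) : Matrix (Fin 3) (Fin 3) F) := by
  haveI : T2Space F := (isLocalField F).toT2Space
  haveI : SecondCountableTopology F := secondCountableTopology_localField F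
  haveI : SecondCountableTopology (Matrix (Fin 3) (Fin 3) F) := inferInstanceAs (SecondCountableTopology (Fin 3 → Fin 3 → F))
  haveI : SecondCountableTopology (Matrix (Fin 3) (Fin 3) F)ᵐᵒᵖ := MulOpposite.opHomeomorph.symm.secondCountableTopology
  haveI : SecondCountableTopology (GL (Fin 3) F) := Units.isEmbedding_embedProduct.secondCountableTopology
  haveI : SecondCountableTopology ↥(glInt 3 F) := TopologicalSpace.Subtype.secondCountableTopology _
  haveI : SecondCountableTopology ↥(unipotentRadicalGL F (id : Fin 3 → Fin 3)) := TopologicalSpace.Subtype.secondCountableTopology _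
  haveI : BorelSpace ↥(glInt 3 F) := Subtype.borelSpace _
  haveI : BorelSpace ↥(unipotentRadicalGL F (id : Fin 3 → Fin 3)) := Subtype.borelSpace _
  haveI : BorelSpace (↥(glInt 3 F) × ↥(unipotentRadicalGL F (id : Fin 3 → Fin 3))) := Prod.borelSpace
  exact (((Units.continuous_val.comp (continuous_subtype_val.comp continuous_fst)).mul
    ((Units.continuous_val.comp (continuous_subtype_val.comp continuous_snd)).sub continuous_const)).mul
    (Units.continuous_coe_inv.comp (continuous_subtype_val.comp continuous_fst))).measurable

/-- **THE DICTIONARY: `Λ_J = (g ↦ g − 1)_* Λ`**, `Λ = (k u k⁻¹)_*(κ ⊗ μ_N)` the group-side Borel unipotent orbital measure (★ p857420).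
[cite: HarishChandra1999AdmissibleDistributions, §3 p. 9] -/
theorem map_borelRichardson_eq_map_map :
    (κ.prod μN).map (fun q : ↥(glInt 3 F) × ↥(unipotentRadicalGL F (id : Fin 3 → Fin 3)) =>
      ((q.1 : GL (Fin 3) F) : Matrix (Fin 3) (Fin 3) F) * (((q.2 : GL (Fin 3) F) : Matrix (Fin 3) (Fin 3) F) - 1) *
        (((q.1 : GL (Fin 3) F)⁻¹ : GL (Fin 3) F) : Matrix (Fin 3) (Fin 3) F)) =
      ((κ.prod μN).map fun q : ↥(glInt 3 F) × ↥(unipotentRadicalGL F (id : Fin 3 → Fin 3)) =>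
        (q.1 : GL (Fin 3) F) * (q.2 : GL (Fin 3) F) * (q.1 : GL (Fin 3) F)⁻¹).map (fun g : GL (Fin 3) F => (g : Matrix (Fin 3) (Fin 3) F) - 1) := by
  haveI : T2Space F := (isLocalField F).toT2Space
  haveI : SecondCountableTopology F := secondCountableTopology_localField F
  haveI : SecondCountableTopology (Matrix (Fin 3) (Fin 3) F) := inferInstanceAs (SecondCountableTopology (Fin 3 → Fin 3 → F))
  haveI : SecondCountableTopology (Matrix (Fin 3) (Fin 3) F)ᵐᵒᵖ := MulOpposite.opHomeomorph.symm.secondCountableTopology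
  haveI : SecondCountableTopology (GL (Fin 3) F) := Units.isEmbedding_embedProduct.secondCountableTopology
  haveI : SecondCountableTopology ↥(glInt 3 F) := TopologicalSpace.Subtype.secondCountableTopology _
  haveI : SecondCountableTopology ↥(unipotentRadicalGL F (id : Fin 3 → Fin 3)) := TopologicalSpace.Subtype.secondCountableTopology _
  haveI : BorelSpace ↥(glInt 3 F) := Subtype.borelSpace _
  haveI : BorelSpace ↥(unipotentRadicalGL F (id : Fin 3 → Fin 3)) := Subtype.borelSpace _
  haveI : BorelSpace (↥(glInt 3 F) × ↥(unipotentRadicalGL F (id : Fin 3 → Fin 3))) := Prod.borelSpace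
  have hσ : Measurable fun g : GL (Fin 3) F => (g : Matrix (Fin 3) (Fin 3) F) - 1 := (Units.continuous_val.sub continuous_const).measurable
  rw [Measure.map_map hσ (continuous_conj_prod F).measurable]
  congr 1
  funext q
  simp only [Function.comp_apply, coe_conj_sub_one]

/-- **`Λ_J` IS `Ad(GL₃(F))`-INVARIANT AS A MEASURE**: `Ad(g)_* Λ_J = Λ_J` for every `g ∈ GL₃(F)` (Haar `κ`, `μ_N`).  From ★ p857420 `GL3.map_conj_borelUnipotentMeasure_eq`
through the dictionary: `Ad(g) ∘ (· − 1) = (· − 1) ∘ Int(g)`. [cite: HarishChandra1999AdmissibleDistributions, §3 p. 9, Thm. 3.9] -/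
theorem GL3.map_Ad_borelRichardsonMeasure_eq [IsHaarMeasure κ] [IsHaarMeasure μN] (g : GL (Fin 3) F) :
    ((κ.prod μN).map fun q : ↥(glInt 3 F) × ↥(unipotentRadicalGL F (id : Fin 3 → Fin 3)) =>
        ((q.1 : GL (Fin 3) F) : Matrix (Fin 3) (Fin 3) F) * (((q.2 : GL (Fin 3) F) : Matrix (Fin 3) (Fin 3) F) - 1) *
          (((q.1 : GL (Fin 3) F)⁻¹ : GL (Fin 3) F) : Matrix (Fin 3) (Fin 3) F)).map
        (fun Y : Matrix (Fin 3) (Fin 3) F => (g : Matrix (Fin 3) (Fin 3) F) * Y * ((g⁻¹ : GL (Fin 3) F) : Matrix (Fin 3) (Fin 3) F)) =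
      (κ.prod μN).map fun q : ↥(glInt 3 F) × ↥(unipotentRadicalGL F (id : Fin 3 → Fin 3)) =>
        ((q.1 : GL (Fin 3) F) : Matrix (Fin 3) (Fin 3) F) * (((q.2 : GL (Fin 3) F) : Matrix (Fin 3) (Fin 3) F) - 1) *
          (((q.1 : GL (Fin 3) F)⁻¹ : GL (Fin 3) F) : Matrix (Fin 3) (Fin 3) F) := by
  haveI : T2Space F := (isLocalField F).toT2Space
  haveI : SecondCountableTopology F := secondCountableTopology_localField F
  haveI : SecondCountableTopology (Matrix (Fin 3) (Fin 3) F) := inferInstanceAs (SecondCountableTopology (Fin 3 → Fin 3 → F))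
  haveI : SecondCountableTopology (Matrix (Fin 3) (Fin 3) F)ᵐᵒᵖ := MulOpposite.opHomeomorph.symm.secondCountableTopology
  haveI : SecondCountableTopology (GL (Fin 3) F) := Units.isEmbedding_embedProduct.secondCountableTopology
  haveI : SecondCountableTopology ↥(glInt 3 F) := TopologicalSpace.Subtype.secondCountableTopology _
  haveI : SecondCountableTopology ↥(unipotentRadicalGL F (id : Fin 3 → Fin 3)) := TopologicalSpace.Subtype.secondCountableTopology _
  haveI : BorelSpace ↥(glInt 3 F) := Subtype.borelSpace _
  haveI : BorelSpace ↥(unipotentRadicalGL F (id : Fin 3 → Fin 3)) := Subtype.borelSpace _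
  haveI : BorelSpace (↥(glInt 3 F) × ↥(unipotentRadicalGL F (id : Fin 3 → Fin 3))) := Prod.borelSpace
  have hσ : Measurable fun h : GL (Fin 3) F => (h : Matrix (Fin 3) (Fin 3) F) - 1 := (Units.continuous_val.sub continuous_const).measurable
  have hAd : Measurable fun Y : Matrix (Fin 3) (Fin 3) F => (g : Matrix (Fin 3) (Fin 3) F) * Y * ((g⁻¹ : GL (Fin 3) F) : Matrix (Fin 3) (Fin 3) F) :=
    ((continuous_const.mul continuous_id).mul continuous_const).measurable
  have hcg : Measurable fun h : GL (Fin 3) F => g * h * g⁻¹ := ((continuous_const.mul continuous_id).mul continuous_const).measurable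
  have hΦ : Measurable fun q : ↥(glInt 3 F) × ↥(unipotentRadicalGL F (id : Fin 3 → Fin 3)) =>
      (q.1 : GL (Fin 3) F) * (q.2 : GL (Fin 3) F) * (q.1 : GL (Fin 3) F)⁻¹ := (continuous_conj_prod F).measurable
  rw [map_borelRichardson_eq_map_map, Measure.map_map hAd hσ]
  have hcomp : ((fun Y : Matrix (Fin 3) (Fin 3) F => (g : Matrix (Fin 3) (Fin 3) F) * Y * ((g⁻¹ : GL (Fin 3) F) : Matrix (Fin 3) (Fin 3) F)) ∘
      fun h : GL (Fin 3) F => (h : Matrix (Fin 3) (Fin 3) F) - 1) = (fun h : GL (Fin 3) F => (h : Matrix (Fin 3) (Fin 3) F) - 1) ∘ fun h : GL (Fin 3) F => g * h * g⁻¹ := by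
    funext h
    simp only [Function.comp_apply, coe_conj_sub_one]
  rw [hcomp, ← Measure.map_map hσ hcg, GL3.map_conj_borelUnipotentMeasure_eq F κ μN g]

omit [ValuativeRel F] [TopologicalSpace F] [IsNonarchimedeanLocalField F] [MeasurableSpace (GL (Fin 3) F)] [BorelSpace (GL (Fin 3) F)]
  [MeasurableSpace (Matrix (Fin 3) (Fin 3) F)] [BorelSpace (Matrix (Fin 3) (Fin 3) F)] in
/-- For `u ∈ N₃` (upper unitriangular), `u − 1` is the strictly upper triangular matrix of its super-diagonal entries. [folklore] -/
theorem coe_sub_one_eq (u : ↥(unipotentRadicalGL F (id : Fin 3 → Fin 3))) :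
    (((u : GL (Fin 3) F)) : Matrix (Fin 3) (Fin 3) F) - 1 =
      !![0, ((u : GL (Fin 3) F) : Matrix (Fin 3) (Fin 3) F) 0 1, ((u : GL (Fin 3) F) : Matrix (Fin 3) (Fin 3) F) 0 2;
         0, 0, ((u : GL (Fin 3) F) : Matrix (Fin 3) (Fin 3) F) 1 2; 0, 0, 0] := by
  obtain ⟨hbt, hdiag⟩ := (mem_unipotentRadicalGL_iff_entry (id : Fin 3 → Fin 3) (u : GL (Fin 3) F)).1 u.2
  have h10 : ((u : GL (Fin 3) F) : Matrix (Fin 3) (Fin 3) F) 1 0 = 0 := hbt (by decide)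
  have h20 : ((u : GL (Fin 3) F) : Matrix (Fin 3) (Fin 3) F) 2 0 = 0 := hbt (by decide)
  have h21 : ((u : GL (Fin 3) F) : Matrix (Fin 3) (Fin 3) F) 2 1 = 0 := hbt (by decide)
  have h00 : ((u : GL (Fin 3) F) : Matrix (Fin 3) (Fin 3) F) 0 0 = 1 := by rw [hdiag 0 0 rfl, Matrix.one_apply_eq]
  have h11 : ((u : GL (Fin 3) F) : Matrix (Fin 3) (Fin 3) F) 1 1 = 1 := by rw [hdiag 1 1 rfl, Matrix.one_apply_eq]
  have h22 : ((u : GL (Fin 3) F) : Matrix (Fin 3) (Fin 3) F) 2 2 = 1 := by rw [hdiag 2 2 rfl, Matrix.one_apply_eq]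
  ext i j
  fin_cases i <;> fin_cases j <;> simp [h10, h20, h21, h00, h11, h22]

omit [ValuativeRel F] [TopologicalSpace F] [IsNonarchimedeanLocalField F] [MeasurableSpace (GL (Fin 3) F)] [BorelSpace (GL (Fin 3) F)]
  [MeasurableSpace (Matrix (Fin 3) (Fin 3) F)] [BorelSpace (Matrix (Fin 3) (Fin 3) F)] in
/-- Powers of a strictly upper triangular `3 × 3` matrix: `Y² = (Y₀₁Y₁₂)·E₁₃` and `Y³ = 0`. [folklore] -/
theorem strictUpper_sq_and_cube (a b c : F) :
    (!![0, a, b; 0, 0, c; 0, 0, 0] : Matrix (Fin 3) (Fin 3) F) * !![0, a, b; 0, 0, c; 0, 0, 0] = !![0, 0, a * c; 0, 0, 0; 0, 0, 0] ∧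
      (!![0, a, b; 0, 0, c; 0, 0, 0] : Matrix (Fin 3) (Fin 3) F) ^ 3 = 0 := by
  constructor
  · ext i j
    fin_cases i <;> fin_cases j <;> simp [Matrix.mul_apply, Fin.sum_univ_three]
  · rw [pow_succ, pow_two]
    ext i j
    fin_cases i <;> fin_cases j <;> simp [Matrix.mul_apply, Fin.sum_univ_three]

/-- **`Λ_J` IS FINITE ON COMPACT SETS**: `Λ_J(C) ≤ Λ(D)` with `D = {h ∈ GL₃(F) | h − 1 ∈ C, (h − 1)³ = 0}`, compact in `GL₃(F)` (the closed embedding `h ↦ (h, h⁻¹)`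
sends `D` into the continuous image `{(1 + Y, 1 − Y + Y²)}` of `C ∩ {Y³ = 0}`), and ★ p857420 `isFiniteMeasureOnCompacts_map_conj_prod`.
[cite: HarishChandra1999AdmissibleDistributions, §3 p. 9] -/
theorem isFiniteMeasureOnCompacts_borelRichardsonMeasure [IsFiniteMeasureOnCompacts κ] [IsFiniteMeasureOnCompacts μN] [SFinite μN] :
    IsFiniteMeasureOnCompacts ((κ.prod μN).map fun q : ↥(glInt 3 F) × ↥(unipotentRadicalGL F (id : Fin 3 → Fin 3)) =>
      ((q.1 : GL (Fin 3) F) : Matrix (Fin 3) (Fin 3) F) * (((q.2 : GL (Fin 3) F) : Matrix (Fin 3) (Fin 3) F) - 1) *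
        (((q.1 : GL (Fin 3) F)⁻¹ : GL (Fin 3) F) : Matrix (Fin 3) (Fin 3) F)) := by
  haveI : T2Space F := (isLocalField F).toT2Space
  haveI : SecondCountableTopology F := secondCountableTopology_localField F
  haveI : SecondCountableTopology (Matrix (Fin 3) (Fin 3) F) := inferInstanceAs (SecondCountableTopology (Fin 3 → Fin 3 → F))
  haveI : SecondCountableTopology (Matrix (Fin 3) (Fin 3) F)ᵐᵒᵖ := MulOpposite.opHomeomorph.symm.secondCountableTopology
  haveI : SecondCountableTopology (GL (Fin 3) F) := Units.isEmbedding_embedProduct.secondCountableTopology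
  haveI : SecondCountableTopology ↥(glInt 3 F) := TopologicalSpace.Subtype.secondCountableTopology _
  haveI : SecondCountableTopology ↥(unipotentRadicalGL F (id : Fin 3 → Fin 3)) := TopologicalSpace.Subtype.secondCountableTopology _
  haveI : BorelSpace ↥(glInt 3 F) := Subtype.borelSpace _
  haveI : BorelSpace ↥(unipotentRadicalGL F (id : Fin 3 → Fin 3)) := Subtype.borelSpace _
  haveI : BorelSpace (↥(glInt 3 F) × ↥(unipotentRadicalGL F (id : Fin 3 → Fin 3))) := Prod.borelSpace
  haveI hΛ := isFiniteMeasureOnCompacts_map_conj_prod F κ μN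
  have hσ : Measurable fun g : GL (Fin 3) F => (g : Matrix (Fin 3) (Fin 3) F) - 1 := (Units.continuous_val.sub continuous_const).measurable
  refine ⟨fun C hC => ?_⟩
  rw [map_borelRichardson_eq_map_map, Measure.map_apply hσ hC.measurableSet, Measure.map_apply (continuous_conj_prod F).measurable (hC.measurableSet.preimage hσ)]
  -- the compact `D' ⊆ GL₃(F)`
  set ρ : Matrix (Fin 3) (Fin 3) F → Matrix (Fin 3) (Fin 3) F × (Matrix (Fin 3) (Fin 3) F)ᵐᵒᵖ :=
    fun Y => (1 + Y, MulOpposite.op (1 - Y + Y * Y)) with hρ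
  have hρc : Continuous ρ := (continuous_const.add continuous_id).prodMk
    (MulOpposite.continuous_op.comp ((continuous_const.sub continuous_id).add (continuous_id.mul continuous_id)))
  have hC3 : IsCompact (C ∩ {Y : Matrix (Fin 3) (Fin 3) F | Y ^ 3 = 0}) := hC.inter_right (isClosed_eq (continuous_id.pow 3) continuous_const)
  have hD : IsCompact ((Units.embedProduct (Matrix (Fin 3) (Fin 3) F)) ⁻¹' (ρ '' (C ∩ {Y | Y ^ 3 = 0}))) :=
    Units.isClosedEmbedding_embedProduct.isCompact_preimage (hC3.image hρc)
  haveI : T2Space (GL (Fin 3) F) := t2Space_generalLinearGroup F 3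
  have hsub : (fun q : ↥(glInt 3 F) × ↥(unipotentRadicalGL F (id : Fin 3 → Fin 3)) => (q.1 : GL (Fin 3) F) * (q.2 : GL (Fin 3) F) * (q.1 : GL (Fin 3) F)⁻¹) ⁻¹'
      ((fun g : GL (Fin 3) F => (g : Matrix (Fin 3) (Fin 3) F) - 1) ⁻¹' C) ⊆
      (fun q : ↥(glInt 3 F) × ↥(unipotentRadicalGL F (id : Fin 3 → Fin 3)) => (q.1 : GL (Fin 3) F) * (q.2 : GL (Fin 3) F) * (q.1 : GL (Fin 3) F)⁻¹) ⁻¹'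
        ((Units.embedProduct (Matrix (Fin 3) (Fin 3) F)) ⁻¹' (ρ '' (C ∩ {Y | Y ^ 3 = 0}))) := fun q hq => by
    -- `k u k⁻¹ ∈ D'`
    have hq' : (((q.1 : GL (Fin 3) F) * (q.2 : GL (Fin 3) F) * (q.1 : GL (Fin 3) F)⁻¹ : GL (Fin 3) F) : Matrix (Fin 3) (Fin 3) F) - 1 ∈ C := hq
    set Y : Matrix (Fin 3) (Fin 3) F := (((q.1 : GL (Fin 3) F) * (q.2 : GL (Fin 3) F) * (q.1 : GL (Fin 3) F)⁻¹ : GL (Fin 3) F) : Matrix (Fin 3) (Fin 3) F) - 1 with hY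
    have hY3 : Y ^ 3 = 0 := by
      rw [hY, coe_conj_sub_one, coe_sub_one_eq]
      have h3 := (strictUpper_sq_and_cube F (((q.2 : GL (Fin 3) F) : Matrix (Fin 3) (Fin 3) F) 0 1) (((q.2 : GL (Fin 3) F) : Matrix (Fin 3) (Fin 3) F) 0 2)
        (((q.2 : GL (Fin 3) F) : Matrix (Fin 3) (Fin 3) F) 1 2)).2
      exact pow_three_eq_zero_of_isNilpotent (isNilpotent_conj _ ⟨3, h3⟩)
    refine ⟨Y, ⟨hq', hY3⟩, ?_⟩
    -- `ρ Y = (h, h⁻¹)` for `h = k u k⁻¹ = 1 + Y`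
    have hh : (((q.1 : GL (Fin 3) F) * (q.2 : GL (Fin 3) F) * (q.1 : GL (Fin 3) F)⁻¹ : GL (Fin 3) F) : Matrix (Fin 3) (Fin 3) F) = 1 + Y := by
      rw [hY, add_sub_cancel]
    have hinv : ((((q.1 : GL (Fin 3) F) * (q.2 : GL (Fin 3) F) * (q.1 : GL (Fin 3) F)⁻¹ : GL (Fin 3) F)⁻¹ : GL (Fin 3) F) : Matrix (Fin 3) (Fin 3) F) = 1 - Y + Y * Y := by
      refine Units.inv_eq_of_mul_eq_one_left ?_
      rw [hh]
      have : (1 - Y + Y * Y) * (1 + Y) = 1 + Y ^ 3 := by noncomm_ring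
      rw [this, hY3, add_zero]
    simp only [hρ, Units.embedProduct_apply, hh, hinv]
  calc (κ.prod μN) _ ≤ (κ.prod μN) _ := measure_mono hsub
    _ = ((κ.prod μN).map fun q : ↥(glInt 3 F) × ↥(unipotentRadicalGL F (id : Fin 3 → Fin 3)) =>
          (q.1 : GL (Fin 3) F) * (q.2 : GL (Fin 3) F) * (q.1 : GL (Fin 3) F)⁻¹) ((Units.embedProduct (Matrix (Fin 3) (Fin 3) F)) ⁻¹' (ρ '' (C ∩ {Y | Y ^ 3 = 0}))) :=
        (Measure.map_apply (continuous_conj_prod F).measurable hD.measurableSet).symm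
    _ < ⊤ := hD.measure_lt_top

end GL3

end Summit.HodgeConjecture.HodgeConjecture.Cruxes.H413.K2E3GL3BorelRichardsonMeasure

end
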